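/- Copyright: the b2b-balaban cell (near-miss cell 7), T⁴-continuum fan-out; row NE7b CRUX team (2), seat
t4-ne7b-formalise-leaf-05 (gen 33) — IR-46-2's standing division «custodian builds, owner X-reads, leaf-05 toy-instantiates»
(`HOME/INBOX.md` l.9196) applied to the OWNER's SPEC D-48-1 «THE PREFIX TWIN» (custodian leaf-03 g27: FILE 1 p289955,
FILE 2 p290621), part 5 of the sanity series (`CLAIMS.log` l.33727).  Released under the licence of the surrounding project. -/
import Summits.QuantumFields.BalabanUV.T4Continuum.Support.HistoryRealiseCellsRunAssemblyWTVSSanityEnd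
import Summits.QuantumFields.BalabanUV.T4Continuum.Support.HistoryRealiseCellsRunAssemblyWTVSDataLW

/-!
# Sanity for the (α) assembly, part 5: A TOY READING OF CONSTANT SIZE AND ONE SET OF LETTERS THE PREFIX TWIN
`HistReadDataLW` ACCEPTS — the cost PINNED at `lamVol`, the floors and `S_h` EXPONENTIATED, (2.7) at `β₀ = 0`, toy constants
`C₃` (companion of `HistoryRealiseCellsRunAssemblyWTVSDataLW` ∕ `…AssemblyWTVSLW`; lineage `t4-ne7b-formalise-leaf-05`
gen 33; part 6 = `…SanityLWData`: the 120-field record on this reading for ANY datum from part 2's displayed inputs;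
part 7 = `…SanityLWEnd`: the record with NO datum hypothesis on the cell's toy datum and FILE 2's `toL` ∕ END run BY NAME
beyond the two coupling windows)

Summits-side support leaf of the T⁴-continuum cell (rung (B)+1 on a FINITE torus only; NOT infinite volume, NOT the
mass gap, NOT Clay; NOT a proof of NE7b — the cell's OWN estimate, NOT PRINTED, NOT PROVED).  [folklore] decided toy
arithmetic over M1's sanity skeleton (`Isk`, `μ₀`), parts 1–2 (`toyR`, `sum_term_toyR`, `trunc₃`, `weightB`, `ZD`, `ZD_pos`),
leaf-06's volume letters (`lamVol`, `uvol`) and the owner's unrounded renewal letter (`sRunr`, `ApFlat`), REUSED BY NAME;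
one toy constants record `C₃`; nothing printed asserted, no `def … : Prop` fact, no cite-tagged hypothesis, zero `sorry`.

§1 THE TOY READING `ℛ₄ L Rc` OF CONSTANT SIZE `Rc` (part 1's `ℛ₃ L` is `Rc := L`): no region, no field, `s := runProfile L R`
((c1) BY CONSTRUCTION), memory `Rm ≡ 2` (`2 ≤ Rc`); the input displays, the flow's K-facts, NO live name ∕ bad term ∕ bad
key class (so `huV`-type, (ρ)∕(ρ′) and «TRUNC» fields are VACUOUS, by design); (2.9) `flow29_const₄` and **(2.7)
`flow27_const`** at `β′ = 0`, ANY `β₀ ≥ 0`, on CONSTANT sizes ∕ couplings (located: the toy cannot exercise `β′ > 0`,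
which print's running flow needs; `β₀` is the record's PARAMETER, free here).
§2 ONE SET OF LETTERS `Φ₄`: the per-cube cost PINNED at leaf-06's `lamVol cΛ g K t` (so FILE 1's ONE new R-display `hΛ` holds
by `log_lamVol`, ANY `cΛ` with `1 ≤ lamVol`), birth factors `exp (−sBsharp O m C g j d′)` (the record's floor `hsB` by
`le_rfl`) and renewal factors `exp (−sRunr … h)` AT THE FIXED LETTER `S_h` (so `hF` by `factorRead_exp` — R-OWNER-47-1 (a)'s
letter is a READING the toy meets with equality); `histRead_toy₄` (empty forest); `ApFlat_ne_zero` (`hAp` from the signs).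
§3 TOY CONSTANTS `C₃ := (13, 0, 2, 1, 1, 0, 0, 0, 0, 0, 1, 2)` — LOCATED: part 1's `C₂` (`q′ = 1`, `E₃ = 0`, `p₀ = 1`) is
REFUSED by the twin (`hE₃pos`; at `rr = 1` the identities `hexpF : 1 + κ₂ = rr·q′`, `hexpB : rr(q′+1) + κ = 2p₀` with
`1 ≤ κ₂, κ` need `2 ≤ q′`, `q′ + 2 ≤ 2p₀`); at `C₃`, `O₁`, `rr = 1` the five identities hold with
`(p₁, η, η′, κ, κ₂, κᵥ) = (4, 2, 1, 1, 1, 3)` (`identities_C₃`, decided).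
HONEST.  A node test of a hypothesis SHAPE at TOY letters (c2): «inhabitable» = «no field unsatisfiable as typed», not
«readings realised non-trivially»; every R∕S field of `HistReadDataLW` stays a HYPOTHESIS of the assembly for real data;
nothing of Bałaban's read, asserted or contested; BY-NAME EFFECT ON THE WALL: NONE; NE7b NOT proved; spine 0∕9.  HONEST
DEPENDENCY (cell): continuum YM on T⁴ ⇐ BetaPertH ∧ nine spine estimates (0/9 proved); BetaPertH ⇐ (D1) ∧ (D4) ∧ CAP+tail;
G-an2-4 gates asym, D1 and NE2/3/4.  Unchanged here.
-/

open Finset MeasureTheory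
open Literature.MathematicalPhysics.QuantumFieldTheory.Balaban1983to89
open Literature.MathematicalPhysics.QuantumFieldTheory.Balaban1983to89.B16SProfile (DropCtl)
open T4PersistenceDictionary T4PersistentHistoryCount T4BankedInduction T4PrintedShapeBanking
open T4WeightBudget T4GlobalDenominator T4LiveClassFibration T4LiveStructureGas T4LiveGasToTerms T4RecordPriceSeam
open T4PartnerMultiplicity T4IndicatorShell T4MatchingAssembly T4MatchingClosure T4MatchingClosureSocket T4Continuum
open T4StabilitySocket T4BranchingRecordsGas T4TaggedShapeBanking T4CanonicalMenus T4RenewalChains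
open Summit.QuantumFields.BalabanUV.T4Continuum.HistoryFlow Summit.QuantumFields.BalabanUV.T4Continuum.HistoryGen
open Summit.QuantumFields.BalabanUV.T4Continuum.HistoryAdmissible
open Summit.QuantumFields.BalabanUV.T4Continuum.HistoryGenealogyExtraction
open Summit.QuantumFields.BalabanUV.T4Continuum.HistoryGenealogyRealise
open Summit.QuantumFields.BalabanUV.T4Continuum.HistoryGenealogyInstantiate
open Summit.QuantumFields.BalabanUV.T4Continuum.HistoryGenealogyPedigree
open Summit.QuantumFields.BalabanUV.T4Continuum.HistoryAssemblyPedigree Summit.QuantumFields.BalabanUV.T4Continuum.HistoryAssemblyTerms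
open Summit.QuantumFields.BalabanUV.T4Continuum.HistoryAssemblyMult Summit.QuantumFields.BalabanUV.T4Continuum.HistoryAssemblyMultKey
open Summit.QuantumFields.BalabanUV.T4Continuum.HistoryAssemblyRealiseRun Summit.QuantumFields.BalabanUV.T4Continuum.HistorySocketTH
open Summit.QuantumFields.BalabanUV.T4Continuum.HistoryRealiseDistinct
open Summit.QuantumFields.BalabanUV.T4Continuum.HistoryRealiseCellsRunApexT3bWTVS
open Summit.QuantumFields.BalabanUV.T4Continuum.B16HistoryIndexedRepr
open Summit.QuantumFields.BalabanUV.T4Continuum.B16HistoryIndexedTrunc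
open Summit.QuantumFields.BalabanUV.T4Continuum.HistoryBankingLE Summit.QuantumFields.BalabanUV.T4Continuum.HistoryBankingVolumePlug
open Summit.QuantumFields.BalabanUV.T4Continuum.HistoryConstants Summit.QuantumFields.BalabanUV.T4Continuum.HistoryBankingDiscountCharge
open Summit.QuantumFields.BalabanUV.T4Continuum.HistoryBankingCreditRead Summit.QuantumFields.BalabanUV.T4Continuum.HistoryBankingFibreRoom
open Summit.QuantumFields.BalabanUV.T4Continuum.HistoryPriceNodeSum Summit.QuantumFields.BalabanUV.T4Continuum.HistoryPriceKeys
open Summit.QuantumFields.BalabanUV.T4Continuum.HistoryRealiseCellsRunSupplyWTVS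
open Summit.QuantumFields.BalabanUV.T4Continuum.HistoryRealiseCellsRunSupplyKeysWTVS
open Summit.QuantumFields.BalabanUV.T4Continuum.HistoryRealiseCellsRunSupplyWTVSSanity
open Summit.QuantumFields.BalabanUV.T4Continuum.HistoryRealiseCellsRunSupplyKeysWTVSSanity
open Summit.QuantumFields.BalabanUV.T4Continuum.HistoryRealiseCellsRunAssemblyWTVSData
open Summit.QuantumFields.BalabanUV.T4Continuum.HistoryRealiseCellsRunAssemblyWTVS
open Summit.QuantumFields.BalabanUV.T4Continuum.HistoryRealiseCellsRunAssemblyWTVSDataL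
open Summit.QuantumFields.BalabanUV.T4Continuum.HistoryRealiseCellsRunAssemblyWTVSDataLW
open Summit.QuantumFields.BalabanUV.T4Continuum.HistoryBankingSharpShares (ell sBsharp)
open Summit.QuantumFields.BalabanUV.T4Continuum.HistoryBankingRoundingUnrounded (sRunr ApFlat)
open Summit.QuantumFields.BalabanUV.T4Continuum.HistoryBankingVolumeWindow (uvol lamVol log_lamVol one_le_lamVol)

namespace Summit.QuantumFields.BalabanUV.T4Continuum.HistoryRealiseCellsRunAssemblyWTVSSanity

noncomputable section

open B16HistoryIndexedRepr.Sanity B16HistoryIndexedRepr.SanityInput HistoryConstants.Sanity HistoryBankingCreditRead.Sanity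

-- the structural `DecidableEq` instance of the concrete tag type exceeds the default synthesis size (as in the siblings)
set_option synthInstance.maxSize 1024

/-! ## §1 The toy reading of constant size `Rc`, its displays, and (2.7)∕(2.9) on constant data -/

/-- **THE TOY READING AT BLOCKING PARAMETER `L` AND CONSTANT SIZE `Rc`**: no new region, no new field; exponents
`s := runProfile L R` ((c1) BY CONSTRUCTION), memory `Rm ≡ 2`.  Part 1's `ℛ₃ L` is the case `Rc := L`. [folklore] -/
def ℛ₄ (L Rc : ℕ) : HistReading Isk 1 where
  L := L
  s := runProfile L (fun _ _ => Rc)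
  R _ _ := Rc
  Rm _ _ _ := 2
  N _ _ _ _ := ∅
  cls _ _ _ _ := 0
  F _ _ _ _ := ∅

variable (L Rc : ℕ)

/-- the runs read off `ℛ₄ L Rc` name no region, hence have no dissolved component at any level [folklore] -/
theorem comp_run_eq_empty₄ (K : ℕ) (τ : HIndex.Idx Isk) (j : ℕ) : ((ℛ₄ L Rc).inputOf.run K τ).histV.comp j = ∅ :=
  ((ℛ₄ L Rc).inputOf.run K τ).comp_histV_eq_empty_of_N (fun _ => rfl) j

/-- the real bookkeeping of the run read off a history choice has no component either [folklore] -/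
theorem compM_runOf_eq_empty₄ (K : ℕ) (a : (Isk K).Adm) (ι : (Isk K).HZ × (Isk K).HL × (Isk K).HC) (j : ℕ) :
    ((ℛ₄ L Rc).runOf K a ι).histM.comp j = ∅ :=
  ((ℛ₄ L Rc).runOf K a ι).comp_histM_eq_empty_of_N (fun _ => rfl) j

/-- … and nothing DIES in them ((ρ0) «no dead indices» holds BY CONSTRUCTION on the toy — the displayed `died_empty` of the
custodian's IR-49-1 `IndexDecor`; a genuine R-display for readings with regions) [folklore] -/
theorem died_run_eq_empty₄ (K : ℕ) (τ : HIndex.Idx Isk) (j : ℕ) : ((ℛ₄ L Rc).inputOf.run K τ).histV.died j = ∅ :=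
  ((ℛ₄ L Rc).inputOf.run K τ).died_histV_eq_empty_of_N (fun _ => rfl) j

/-- NO LIVE NAME at any cutoff [folklore] -/
theorem liveCV_eq_empty₄ (K : ℕ) (τ : HIndex.Idx Isk) : (ℛ₄ L Rc).inputOf.liveCV K τ = ∅ := by
  show (((ℛ₄ L Rc).inputOf.run K τ).histV.comp K).image (Prod.mk K) = ∅
  rw [comp_run_eq_empty₄, Finset.image_empty]

/-- the displayed input condition `NewOK` (vacuous) [folklore] -/
theorem newOK_run₄ (K : ℕ) (τ : HIndex.Idx Isk) : ((ℛ₄ L Rc).inputOf.run K τ).NewOK :=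
  ⟨fun _ _ hn => by simp [HistReading.inputOf, ℛ₄] at hn⟩

/-- disjoint new regions (vacuous) [folklore] -/
theorem newDisjoint_run₄ (K : ℕ) (τ : HIndex.Idx Isk) : ((ℛ₄ L Rc).inputOf.run K τ).NewDisjoint :=
  fun _ _ hn => by simp [HistReading.inputOf, ℛ₄] at hn

/-- the L-chain's input display `RegionsInBox` (vacuous: no new region) [folklore] -/
theorem regionsInBox_run₄ (n K : ℕ) (τ : HIndex.Idx Isk) : ((ℛ₄ L Rc).inputOf.run K τ).RegionsInBox n K :=
  fun _ _ _ hn => by simp [HistReading.inputOf, ℛ₄] at hn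

variable {Rc} in
/-- memory domination `Rm ≤ R` (`2 ≤ Rc`) [folklore] -/
theorem rm_le_run₄ (hRc : 2 ≤ Rc) (K : ℕ) (τ : HIndex.Idx Isk) :
    ∀ t k, ((ℛ₄ L Rc).inputOf.run K τ).Rm t k ≤ ((ℛ₄ L Rc).inputOf.run K τ).R t := fun _ _ => hRc

variable {Rc} in
/-- its one-step form [folklore] -/
theorem rmS_run₄ (hRc : 2 ≤ Rc) (K : ℕ) (τ : HIndex.Idx Isk) :
    ∀ t k, ((ℛ₄ L Rc).inputOf.run K τ).Rm t (k + 1) ≤ ((ℛ₄ L Rc).inputOf.run K τ).R (t + 1) := fun _ _ => hRc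

/-- non-degenerate memory `2 ≤ Rm t 1` [folklore] -/
theorem rm2_run₄ (K : ℕ) (τ : HIndex.Idx Isk) : ∀ t, 2 ≤ ((ℛ₄ L Rc).inputOf.run K τ).Rm t 1 := fun _ => le_rfl

/-- the flow's K-fact `hprof` on the toy: the run's own profile of constant sizes is constant [folklore] -/
theorem runProfile_succ_le_toy₄ (K t : ℕ) : runProfile L (ℛ₄ L Rc).R K (t + 1) ≤ runProfile L (ℛ₄ L Rc).R K t :=
  le_of_eq rfl

/-- the flow's K-fact `hdrop` on the toy: a constant profile has drop control at every horizon [folklore] -/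
theorem dropCtl_runProfile_toy₄ (K m : ℕ) : DropCtl (runProfile L (ℛ₄ L Rc).R K) m := fun i k _ _ => by
  show 2 * Nat.log L Rc ≤ 2 * Nat.log L Rc + max (k - i) 2
  exact Nat.le_add_right _ _

variable {L Rc} in
/-- **(2.9) on constant sizes at `β′ = 0`** (any couplings, ANY real exponent `β₀`, `1 ≤ L`): both members read
`Rc ≤ L·Rc`. [folklore] -/
theorem flow29_const₄ (hL : 1 ≤ L) (g : ℕ → ℝ) (β₀ : ℝ) (K : ℕ) :
    B14FlowStep.FlowIneq29 ((ℛ₄ L Rc).R K) g L 0 β₀ K := fun m n _ _ => by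
  have hL1 : (Rc : ℝ) ≤ L * Rc := le_mul_of_one_le_left (Nat.cast_nonneg _) (by exact_mod_cast hL)
  refine ⟨hL1, ?_⟩
  show (Rc : ℝ) ≤ L * (1 + g n ^ 2 * 0 * ((n : ℝ) - m)) ^ β₀ * Rc
  rw [mul_zero, zero_mul, add_zero, Real.one_rpow, mul_one]
  exact hL1

/-- **(2.7) ON CONSTANT COUPLINGS at `β′ = 0`** (ANY `β₀ ≥ 0`, any power, `ℓ^p ≥ 0`): `ℓ^p ≤ (1+β₀)·ℓ^p` and
`ℓ^p ≤ 1^{β₀}·ℓ^p`.  LOCATED: a constant flow meets (2.7) at `β′ = 0`; print's RUNNING flow needs `β′ > 0` in the second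
member — not exercisable on the cell's toy datum (constant flow); `β₀` is the record's PARAMETER. [folklore] -/
theorem flow27_const (c : ℝ) {β₀ : ℝ} (hβ₀ : 0 ≤ β₀) (p K : ℕ) (hℓ : 0 ≤ Real.log (c ^ 2)⁻¹ ^ p) :
    B14.FlowIneq27 (fun _ => c) 0 β₀ p K := fun m n _ _ => by
  refine ⟨?_, ?_⟩
  · show Real.log (c ^ 2)⁻¹ ^ p ≤ (1 + β₀) * Real.log (c ^ 2)⁻¹ ^ p
    nlinarith
  · show Real.log (c ^ 2)⁻¹ ^ p ≤ (1 + c ^ 2 * 0 * ((n : ℝ) - m)) ^ β₀ * Real.log (c ^ 2)⁻¹ ^ p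
    rw [mul_zero, zero_mul, add_zero, Real.one_rpow, one_mul]

/-- no bad term (pointwise; for the vacuous key-free fields) [folklore] -/
theorem not_mem_badTerms₄ {γ : Type*} [DecidableEq γ] (cellOf : ℕ → HIndex.Idx Isk → ℕ × Lab 1 → γ) (jstar : ℕ → ℕ)
    (K : ℕ) (τ : HIndex.Idx Isk) :
    τ ∉ badTerms (memOf (ℛ₄ L Rc).inputOf.pedV (ℛ₄ L Rc).inputOf.liveCV cellOf) jstar (HIndex.termSet Isk) K := by
  intro h
  have h' := (Finset.mem_filter.1 h).2
  unfold memOf at h'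
  rw [liveCV_eq_empty₄, Finset.image_empty] at h'
  simp at h'

/-- NO bad key class (pointwise; for the vacuous (ρ)∕(ρ′)∕«TRUNC» readings) [folklore] -/
theorem not_mem_badGMems₄ {γ δ : Type*} [DecidableEq γ] [DecidableEq δ] (cellOf : ℕ → HIndex.Idx Isk → ℕ × Lab 1 → γ)
    (phys : ℕ → HIndex.Idx Isk → ℕ × Lab 1 → δ) (jstar : ℕ → ℕ) (K : ℕ) (k : Finset (γ × Gen PEv × δ)) :
    k ∉ badGMems (memOf (ℛ₄ L Rc).inputOf.pedV (ℛ₄ L Rc).inputOf.liveCV cellOf) jstar (HIndex.termSet Isk)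
      (kmemOf (ℛ₄ L Rc).inputOf.pedV (ℛ₄ L Rc).inputOf.liveCV cellOf phys) K := by
  intro h
  obtain ⟨τ, hτ, -⟩ := Finset.mem_image.1 h
  exact not_mem_badTerms₄ L Rc cellOf jstar K τ hτ

/-! ## §2 One set of toy letters: the cost PINNED at `lamVol`, the floors and `S_h` EXPONENTIATED -/

section Letters

variable (O : PrintedO1s) (m : ℝ) (C : T4PrintedShapeBanking.Consts) (Lr : ℝ) (p₁ Rc : ℕ) (cΛ : ℝ)
  (g : ℕ → ℕ → ℝ) (Z : ℕ → ℝ → ℝ)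

/-- **TOY FACTOR DATA FOR THE PREFIX TWIN** at the running couplings `g K` of run `K` and a given generating function
`Z K t`: birth factors `exp (−sBsharp O m C (g K) j d′)`, renewal factors `exp (−S_h)` at the owner's unrounded letter
`sRunr … (R ≡ Rc) (g K) h`, per-cube cost `lamVol cΛ (g K) K t` (leaf-06's pinned letter; `1 ≤` displayed as `hΛ1`), unit
envelopes, zero last-exponent envelope, completed-action envelope `log (Z K t ∕ 6)` (part 1's). [folklore] -/
def Φ₄ (hΛ1 : ∀ K t, 1 ≤ lamVol cΛ (g K) K t) : HistFactors Isk 1 where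
  fB K j d _ := Real.exp (-sBsharp O m C (g K) j d)
  fR K h := Real.exp (-sRunr O.γ₀ O.A₁ O.M Lr O.β₀ O.d p₁ (fun _ => Rc) (g K) h)
  Λ K t := lamVol cΛ (g K) K t
  one_le_Λ := hΛ1
  wZ _ _ _ _ := 1
  wY _ _ _ _ := 1
  wC _ _ _ _ := 1
  BA K t := Real.log (Z K t / 6)
  BV _ _ _ _ _ _ := 0

variable (hΛ1 : ∀ K t, 1 ≤ lamVol cΛ (g K) K t)

/-- **THE FACTOR READING HOLDS AT THE FIXED LETTER `S_h`** (and at the floor `sBsharp`) — with equality. [folklore] -/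
theorem factorRead_toy₄ (L K : ℕ) :
    FactorRead ((Φ₄ O m C Lr p₁ Rc cΛ g Z hΛ1).fB K) ((Φ₄ O m C Lr p₁ Rc cΛ g Z hΛ1).fR K) (sBsharp O m C (g K))
      (sRunr O.γ₀ O.A₁ O.M Lr O.β₀ O.d p₁ ((ℛ₄ L Rc).R K) (g K)) :=
  factorRead_exp _ _

/-- **THE PIN**: FILE 1's one new R-display `hΛ` holds by leaf-06's `log_lamVol`. [folklore] -/
theorem log_Λ_toy₄ (K t : ℕ) : Real.log ((Φ₄ O m C Lr p₁ Rc cΛ g Z hΛ1).Λ K t) = uvol cΛ (g K) K t :=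
  log_lamVol cΛ (g K) K t

/-- **`HistRead` HOLDS** for `Φ₄` and the toy expansions on the toy reading (empty forest; envelopes attained; source
radius `1`, threshold `0`). [folklore] -/
theorem histRead_toy₄ (L : ℕ) : HistRead (ℛ₄ L Rc) (Φ₄ O m C Lr p₁ Rc cΛ g Z hΛ1) (fun K t => toyR (Z K t)) 1 0 where
  χ01 _ _ _ _ := ⟨zero_le_one, le_rfl⟩
  tz_le _ _ _ _ _ _ _ _ := le_of_eq rfl
  ty_le _ _ _ _ _ _ _ _ := le_of_eq rfl
  tc_le _ _ _ _ _ _ _ _ := le_of_eq rfl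
  A'_le _ _ _ _ _ := le_rfl
  Vs_le _ _ _ _ _ _ _ _ _ := le_rfl
  forest_le K t _ _ a ι _ := by
    show (1 : ℝ) * 1 ≤ _
    rw [Finset.prod_congr rfl fun j _ => by rw [compM_runOf_eq_empty₄ L Rc K a ι j, Finset.prod_empty],
      Finset.prod_const_one]
    norm_num

variable {Z} in
/-- the completed-action envelope is bounded along `|t| ≤ 1` by `log (Zi∕6)` when the generating function is [folklore] -/
theorem BA_le_of_le₄ {Zi : ℝ} (hpos : ∀ K t, |t| ≤ 1 → 0 < Z K t) (hle : ∀ K t, |t| ≤ 1 → Z K t ≤ Zi) (K : ℕ) {t : ℝ}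
    (ht : |t| ≤ 1) : (Φ₄ O m C Lr p₁ Rc cΛ g Z hΛ1).BA K t ≤ Real.log (Zi / 6) :=
  Real.log_le_log (by have := hpos K t ht; positivity) (by have := hle K t ht; linarith)

end Letters

/-- **THE FLAT RENEWAL AMPLITUDE IS NONZERO** from the signs `0 < γ₀`, `A₁ ≠ 0`, `0 < M`, `0 ≤ Lr` (FILE 1's `hAp` on any
constants with these signs). [folklore] -/
theorem ApFlat_ne_zero {γ₀ A₁ M Lr : ℝ} (hγ₀ : 0 < γ₀) (hA₁ : A₁ ≠ 0) (hM : 0 < M) (hLr : 0 ≤ Lr) (d : ℕ) :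
    ApFlat γ₀ A₁ M Lr d ≠ 0 := by
  unfold ApFlat
  have hA : 0 < A₁ ^ 2 := by positivity
  exact (Real.sqrt_pos.2 (by positivity)).ne'

/-! ## §3 Toy constants the twin accepts, and the census identities at them (decided) -/

/-- **TOY MODEL CONSTANTS FOR THE PREFIX TWIN** `(n₁, dC, q′, E₂, E₃, κ₁, E₀, Eb, μ, a, A₀, p₀) = (13, 0, 2, 1, 1, 0, 0, 0, 0,
0, 1, 2)` — TOY symbols meeting `13 ≤ n₁`, `0 < E₂`, `0 < E₃`, `1 ≤ p₀`, `0 < A₀` and, at `rr = 1`, the census identities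
(`identities_C₃`); not print's values (c2).  Part 1's `C₂` has `E₃ = 0`, `q′ = 1`, `p₀ = 1` — refused by `hE₃pos`,
`hexpF`, `hexpB`. [folklore] -/
def C₃ : T4PrintedShapeBanking.Consts := ⟨13, 0, 2, 1, 1, 0, 0, 0, 0, 0, 1, 2⟩

/-- the five census identities and the gaps at `C₃`, `O₁` (`d = 1`), `rr = 1`, `(p₁, η, η′, κ, κ₂, κᵥ) = (4, 2, 1, 1, 1, 3)`
[decided toy] -/
theorem identities_C₃ :
    C₃.p₀ + 1 * (O₁.d + 3) + 2 = 2 * 4 ∧ 1 * (C₃.q' + 1) + 1 * (O₁.d + 3) + 1 = 2 * 4 ∧ 1 * (C₃.q' + 1) + 1 = 2 * C₃.p₀ ∧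
      1 + 1 = 1 * C₃.q' ∧ 1 + 3 = 2 * C₃.p₀ ∧ (1 : ℕ) ≤ 2 ∧ (1 : ℕ) ≤ 1 ∧ (1 : ℕ) ≤ 3 ∧ 1 ≤ C₃.p₀ := by
  simp [C₃, O₁]

end

end Summit.QuantumFields.BalabanUV.T4Continuum.HistoryRealiseCellsRunAssemblyWTVSSanity
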